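import Literature.AlgebraicGeometry.Motives.JacobianThetaDivisor
import Mathlib.AlgebraicGeometry.Geometrically.Irreducible
import HarnessLib

/-!
# The fibre powers `C^r` of a geometrically irreducible `k`-scheme are irreducible, and the Brill–Noether loci
# `W̃_r(P) = \overline{α_{rP}(C^r)}` of a Jacobian are irreducible

Layer `Literature/AlgebraicGeometry/Motives`, namespaces `Literature.AlgebraicGeometry.RelativeSpec` (§1) and
`Literature.AlgebraicGeometry.Motives.Jacobian` (§2).  KERNEL ONLY: theorems; no definition, no named fact, no instance,
no `sorry`.

* §1 `RelativeSpec.irreducibleSpace_powOver` — for `r : X → Y` geometrically irreducible and universally open (e.g. any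
  scheme of finite type and geometrically irreducible over a field) with `Y` irreducible, the wide fibre power
  `X ×_Y ⋯ ×_Y X` (the tree's `powOver r n`) is irreducible: induction along ★ `powSuccIso : Xⁿ⁺¹_Y ≅ Xⁿ_Y ×_Y X` and
  Mathlib's `IrreducibleSpace (pullback f g)` for a geometrically irreducible universally open factor ([GortzWedhorn2020]
  Prop. 5.50 (ii): products of geometrically irreducible schemes over a field).
* §2 **`Jacobian.isIrreducible_brillNoetherLocus`** — the locus `W̃_r(P) ⊆ J` (★ `Jacobian.brillNoetherLocus`, the closure
  of the image of the Abel sum map `α_{rP} : C^r → J`) is IRREDUCIBLE for a geometrically irreducible `k`-scheme `C`, in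
  particular for a smooth projective geometrically irreducible curve (`…_of_isSmoothProjective`): the
  continuous image of the irreducible `C^r` and its closure are irreducible ([Lange2023AbelianVarietiesComplex] §4.2.1
  Lemma 4.2.1 (ii) «`W_n` is irreducible and closed», proof: image of the irreducible `C^{(n)}`; [Milne1986JacobianVarieties]
  §5 «`W^r` is a closed subvariety of `J`»).

Use (cell `hodgecm-mathlib`, D-0151; crux HLiu418 = stmt-HodgeConjecture-24832, route G3 = the (Θ-uniq) chain, leaf (i-a),
letter `ThetaUniq.sockets` of A-p16 (g14)): the irreducibility of the support `t_x(W̃_{g−1})` of a Riemann theta divisor is the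
input of the multiplicity step «an effective divisor with irreducible support is a multiple of it».  COUNT-NEUTRAL.  HC_CM is
proved only modulo the 7 printed citations until rung 0 closes; this file moves no book by itself.

## References
* [GortzWedhorn2020] U. Görtz, T. Wedhorn, *Algebraic Geometry I*, 2nd ed. (2020), Prop. 5.50 (ii).
* [Lange2023AbelianVarietiesComplex] H. Lange, *Abelian Varieties over the Complex Numbers* (2023), §4.2.1 Lemma 4.2.1 (ii).
* [Milne1986JacobianVarieties] J. S. Milne, *Jacobian Varieties*, in Cornell–Silverman (1986), §5 (the maps `f^r`, `W^r`).
-/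

set_option autoImplicit false

noncomputable section

open CategoryTheory CategoryTheory.Limits AlgebraicGeometry

universe u

namespace Literature.AlgebraicGeometry

namespace RelativeSpec

/-! ## §1 Fibre powers of a geometrically irreducible universally open `X → Y` are irreducible -/

variable {X Y : Scheme.{u}} (r : X ⟶ Y)

/-- Irreducibility is transported along isomorphisms of schemes. [folklore] -/
private theorem irreducibleSpace_of_iso {Z W : Scheme.{u}} (e : Z ≅ W) [IrreducibleSpace Z] : IrreducibleSpace W := by
  have h : Set.range e.hom.base = Set.univ := by
    refine Set.eq_univ_of_forall fun w => ⟨e.inv.base w, ?_⟩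
    change (e.inv ≫ e.hom) w = w
    rw [e.inv_hom_id]
    rfl
  rw [irreducibleSpace_def, Set.top_eq_univ, ← h, ← Set.image_univ]
  exact (IrreducibleSpace.isIrreducible_univ Z).image _ e.hom.continuous.continuousOn

/-- **`X ×_Y ⋯ ×_Y X` is irreducible** when `X → Y` is geometrically irreducible and universally open and `Y` is irreducible
(induction on the number of factors along `Xⁿ⁺¹_Y ≅ Xⁿ_Y ×_Y X`; Görtz–Wedhorn I Prop. 5.50 (ii) for products over a field).
[cite: GortzWedhorn2020, Prop. 5.50 (ii)] -/
theorem irreducibleSpace_powOver [GeometricallyIrreducible r] [UniversallyOpen r] [IrreducibleSpace Y] :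
    ∀ n : ℕ, IrreducibleSpace (powOver r n)
  | 0 => irreducibleSpace_of_iso (asIso (powOver.base r 0)).symm
  | n + 1 => by
    haveI := irreducibleSpace_powOver n
    haveI : IrreducibleSpace ↥(pullback (powOver.base r n) r) := inferInstance
    exact irreducibleSpace_of_iso (powSuccIso r n).symm

/-- The same for the `Over`-packaged power `powOverObj r n`. [cite: GortzWedhorn2020, Prop. 5.50 (ii)] -/
theorem irreducibleSpace_powOverObj_left [GeometricallyIrreducible r] [UniversallyOpen r] [IrreducibleSpace Y] (n : ℕ) :
    IrreducibleSpace (powOverObj r n).left :=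
  irreducibleSpace_powOver r n

/-- **Over a field**: the fibre powers `C ×_k ⋯ ×_k C` of a geometrically irreducible `k`-scheme are irreducible
(`Spec k` is irreducible, and every morphism to the spectrum of a field is universally open).
[cite: GortzWedhorn2020, Prop. 5.50 (ii)] -/
theorem irreducibleSpace_powOverObj_left_of_field {k : Type u} [Field k] (C : Motives.SchemeOver k)
    [GeometricallyIrreducible C.hom] (n : ℕ) : IrreducibleSpace (powOverObj C.hom n).left := by
  haveI : UniversallyOpen C.hom := inferInstance
  exact irreducibleSpace_powOver C.hom n

end RelativeSpec

namespace Motives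

namespace Jacobian

open Literature.AlgebraicGeometry.RelativeSpec

variable {k : Type u} [Field k] {C : SchemeOver k}

/-! ## §2 The Brill–Noether loci `W̃_r(P)` are irreducible -/

/-- **`W̃_r(P)` is irreducible** for a geometrically irreducible `k`-scheme `C` with a Jacobian `𝒥` and a rational point `P`: it is the closure of the image of the irreducible `C^r` under the (continuous) Abel sum map `α_{rP}`
(Lange Lemma 4.2.1 (ii): «`W_n` is irreducible», being the image of `C^{(n)}`; Milne §5 `W^r`).
[cite: Lange2023AbelianVarietiesComplex, §4.2.1 Lemma 4.2.1 (ii)] [cite: Milne1986JacobianVarieties, §5 (the maps f^r : C^r → J, W^r)] -/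
theorem isIrreducible_brillNoetherLocus [GeometricallyIrreducible C.hom] (𝒥 : Jacobian C)
    (P : AlgPoints C k) (r : ℕ) : IsIrreducible (𝒥.brillNoetherLocus P r) := by
  haveI : IrreducibleSpace (powOverObj C.hom r).left := irreducibleSpace_powOverObj_left_of_field C r
  unfold brillNoetherLocus
  rw [← Set.image_univ]
  exact ((IrreducibleSpace.isIrreducible_univ _).image _ (𝒥.abelSum P r).left.continuous.continuousOn).closure

/-- **`W̃_r(P)` is irreducible for a smooth projective (geometrically irreducible) `k`-scheme `C`** — the binders of the
tree's `IsSmoothProjective`. [cite: Lange2023AbelianVarietiesComplex, §4.2.1 Lemma 4.2.1 (ii)] [cite: Milne1986JacobianVarieties, §5 (the maps f^r : C^r → J, W^r)] -/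
theorem isIrreducible_brillNoetherLocus_of_isSmoothProjective {n : ℕ} (hC : IsSmoothProjective n C) (𝒥 : Jacobian C)
    (P : AlgPoints C k) (r : ℕ) : IsIrreducible (𝒥.brillNoetherLocus P r) := by
  haveI := hC.geometricallyIrreducible
  exact isIrreducible_brillNoetherLocus 𝒥 P r

/-- **Translates of `W̃_r(P)` are irreducible** (a translation is a homeomorphism of `J`); in particular the support
`t_x(W̃_{g−1}(P))` of a Riemann theta divisor (★ `Jacobian.IsRiemannThetaDivisor`) is irreducible.
[cite: Lange2023AbelianVarietiesComplex, §4.2.1 Lemma 4.2.1 (ii) and Cor. 4.2.4] -/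
theorem isIrreducible_image_translation_brillNoetherLocus [GeometricallyIrreducible C.hom] (𝒥 : Jacobian C) (P : AlgPoints C k) (r : ℕ) (x : 𝒥.J.Points k) :
    IsIrreducible ((𝒥.J.translation x).left.base '' 𝒥.brillNoetherLocus P r) :=
  (isIrreducible_brillNoetherLocus 𝒥 P r).image _ (𝒥.J.translation x).left.continuous.continuousOn

/-- **The support of a Riemann theta divisor is irreducible** (it is a translate `t_x(W̃_{g−1}(P))`), for a smooth
projective geometrically irreducible curve. [cite: Lange2023AbelianVarietiesComplex, §4.2.1 Lemma 4.2.1 (ii) and Cor. 4.2.4]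
[cite: Milne1986JacobianVarieties, §6 (Θ = W^{g-1}, before Thm. 6.6)] -/
theorem IsRiemannThetaDivisor.isIrreducible_support {n : ℕ} (hC : IsSmoothProjective n C) {𝒥 : Jacobian C}
    {Θ : CartierDivisor 𝒥.J.X.left} (h : 𝒥.IsRiemannThetaDivisor Θ) : IsIrreducible (Θ.nonvanishing 1)ᶜ := by
  obtain ⟨P, x, hsupp⟩ := h.exists_support_eq
  haveI := hC.geometricallyIrreducible
  rw [hsupp]
  exact isIrreducible_image_translation_brillNoetherLocus 𝒥 P _ x

end Jacobian

end Motives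

end Literature.AlgebraicGeometry

end
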